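import Mathlib
import HarnessLib
import Summits.RiemannHypothesis.RiemannHypothesis.Theorems.DBNCauchyFourier
import Summits.RiemannHypothesis.RiemannHypothesis.Theses.NbSectionTwoDyadic

/-!
# RiemannHypothesis / NbSectionTwoDyadic — Fourier transform of the Poisson kernel of the
critical-line measure

Route `NbSectionTwoDyadic`, support item `PoissonKernelFourier` (stmt-RiemannHypothesis-22783):
`∫ cos(tx) / (1/4 + t²) dt = 2π e^{−|x|/2}` for every real `x`.

Proof: the tree already holds the Fourier transform of the Cauchy kernel,
`𝓕[a/(s²+a²)](w) = π e^{−2πa|w|}` (`Theorems/DBNCauchyFourier.lean`, `fourier_cauchyC`, obtained from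
Mathlib's Fourier inversion). Take `a = 1/2`, evaluate at `w = −x/(2π)` to get the complex pairing
`∫ e^{itx} (1/2)/(t² + 1/4) dt = π e^{−|x|/2}`, and take real parts (`integral_re`).

Known classical calculus ([folklore]; Beurling 1955 / Báez-Duarte 2003 use it as the pairing
`∫ m^{−1/2−it} n^{−1/2+it} dt/(1/4+t²) = 2π/max(m,n)`). RH-free. No summit is proved by this file;
nothing here bears on the truth of RH.
-/

noncomputable section

-- D-0017: `Summit.<S>.<S>.…` is the designed namespace of a single-problem summit.
set_option linter.dupNamespace false

open scoped Real FourierTransform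
open MeasureTheory Complex Filter

namespace Summit.RiemannHypothesis.RiemannHypothesis.Theorems.NbSectionTwo

open Summit.RiemannHypothesis.RiemannHypothesis.Theorems.DbnTheory

/-- The complex pairing against the Poisson kernel of the critical line:
`∫ e^{ivx} · (1/2)/(v² + 1/4) dv = π e^{−|x|/2}` — the Fourier transform of the Cauchy kernel
(`fourier_cauchyC`, `a = 1/2`) evaluated at `w = −x/(2π)`. [folklore] -/
theorem integral_cexp_mul_cauchyHalf (x : ℝ) :
    ∫ v : ℝ, Complex.exp (↑(v * x) * I) * ((((1 / 2 : ℝ) / (v ^ 2 + (1 / 2 : ℝ) ^ 2)) : ℝ) : ℂ)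
      = ((π * Real.exp (-|x| / 2) : ℝ) : ℂ) := by
  have h := congrFun (fourier_cauchyC (1 / 2 : ℝ) (by norm_num)) (-x / (2 * π))
  rw [Real.fourier_real_eq_integral_exp_smul] at h
  have hπ : π ≠ 0 := Real.pi_pos.ne'
  have harg : ∀ v : ℝ, -2 * π * v * (-x / (2 * π)) = v * x := by
    intro v
    field_simp
  have habs : -(2 * π * (1 / 2 : ℝ) * |-x / (2 * π)|) = -|x| / 2 := by
    rw [abs_div, abs_neg, abs_of_pos (by positivity : (0 : ℝ) < 2 * π)]
    field_simp
  simp_rw [harg, smul_eq_mul] at h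
  rw [h, habs]

/-- The modulated Poisson kernel `v ↦ e^{ivx} (1/2)/(v² + 1/4)` is integrable. [folklore] -/
theorem integrable_cexp_mul_cauchyHalf (x : ℝ) :
    Integrable fun v : ℝ =>
      Complex.exp (↑(v * x) * I) * ((((1 / 2 : ℝ) / (v ^ 2 + (1 / 2 : ℝ) ^ 2)) : ℝ) : ℂ) := by
  refine (integrable_cauchyC (1 / 2 : ℝ) (by norm_num)).bdd_mul (c := 1)
    (by fun_prop : Continuous fun v : ℝ => Complex.exp (↑(v * x) * I)).aestronglyMeasurable
    (Eventually.of_forall fun v => ?_)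
  rw [Complex.norm_exp_ofReal_mul_I]

/-- The real pairing: `∫ cos(vx) · (1/2)/(v² + 1/4) dv = π e^{−|x|/2}`. [folklore] -/
theorem integral_cos_mul_cauchyHalf (x : ℝ) :
    ∫ v : ℝ, Real.cos (v * x) * ((1 / 2) / (v ^ 2 + (1 / 2) ^ 2)) = π * Real.exp (-|x| / 2) := by
  have hre := integral_re (integrable_cexp_mul_cauchyHalf x)
  simp only [RCLike.re_to_complex] at hre
  rw [integral_cexp_mul_cauchyHalf x, Complex.ofReal_re] at hre
  rw [← hre]
  refine integral_congr_ae (Eventually.of_forall fun v => ?_)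
  dsimp only
  rw [Complex.re_mul_ofReal, Complex.exp_ofReal_mul_I_re]

/-- **Support item `PoissonKernelFourier`** (stmt-RiemannHypothesis-22783) of route
`NbSectionTwoDyadic`: `∫ cos(tx)/(1/4 + t²) dt = 2π e^{−|x|/2}` for every real `x` — the Fourier
transform of the Poisson kernel of the critical-line measure `dt/(1/4+t²)`. RH-free; no summit is
proved by this. [folklore] -/
theorem PoissonKernelFourier_proof :
    Summit.RiemannHypothesis.RiemannHypothesis.Theses.NbSectionTwoDyadic.PoissonKernelFourier := by
  unfold Summit.RiemannHypothesis.RiemannHypothesis.Theses.NbSectionTwoDyadic.PoissonKernelFourier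
  intro x
  have h2 : (fun t : ℝ => Real.cos (t * x) / (1 / 4 + t ^ 2))
      = fun t : ℝ => 2 * (Real.cos (t * x) * ((1 / 2) / (t ^ 2 + (1 / 2) ^ 2))) := by
    funext t
    have ht : (0 : ℝ) < 1 / 4 + t ^ 2 := by positivity
    field_simp
    ring
  rw [h2, integral_const_mul, integral_cos_mul_cauchyHalf x]
  ring

end Summit.RiemannHypothesis.RiemannHypothesis.Theorems.NbSectionTwo

end
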